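import Literature.AlgebraicGeometry.Frobenioids.PadicFieldwiseSaturatedGaloisBase
import HarnessLib

/-!
# Frobenioids II, Example 1.3 / Theorem 2.4 (i) proof p. 20: Galois theory on the coset objects `G_{ℚ_p}/W` of
# `B^temp(G_{ℚ_p})⁰` — base points, fixed fields, Galois DESCENT along `G/W₁ → G/W₂`, roots of uniformizers

Mochizuki, *The geometry of Frobenioids II*, Kyushu J. Math. **62** (2008) 401–460, Example 1.3 (i)–(iii) pp. 11–12
[cite: MochizukiFrdII2008, Ex 1.3 (iii) pp.11-12] (the Galois-correspondence base `B^temp(G_{ℚ_p})⁰ → D₀`, "the set of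
cosets `Π/Π°` equipped with its natural `Π`-action") and Theorem 2.4 (i), proof p. 20 ll. 9–22
[cite: MochizukiFrdII2008, Thm 2.4 (i) p.20] (condition (b): "`O^⊳(C) ⥲ O^⊳(B)^{Gal(B/C)}`"; the variation of `B` over covers
realising ramification).

PROOF-ONLY file (abc-iut cell, seat abc-iut-w5-d229; SUBDAG-FrdII-Thm24 row **W12-L01b**, GAP-LEDGER **G-w5d229-1**; no
definitions): the `G_{ℚ_p}`-level Galois theory needed to discharge the base binders `hfix` / `hram` of
`PadicFrd.Datum.isFieldwiseSaturated_iff_divisible_and_descent` over the GENERAL printed base `B^temp(Π, Π°)⁰ → D₀` of §2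
(sequel file `PadicFieldwiseSaturatedTemperedBase.lean`), where the Galois objects `Π/U` (`U ⊴ Π`) are NOT Galois in
`B^temp(G_{ℚ_p})⁰` (their images `G/φ(U)` have `φ(U) ⊴ G_K` only), so that abc-iut-w5-d174's `galoisPadicFields_hfix` does not
apply. Everything is phrased on the small model `CosetCat (GalFbar ℚ_[p])` through the bridge `CosetCat.toConnected`
(abc-iut-L1/L5 `CosetCategories*.lean`) and abc-iut-L1's valued Galois correspondence `QuasiTemperoid.galoisPadicFields`:

* `QuasiTemperoid.ρ_basePt_eq_iff`, `mem_fixFld_toConnected_iff` — if the chosen base point of `G/W` is `g₁W`, its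
  stabiliser is `g₁Wg₁⁻¹` and `K_{G/W} = ℚ̄_p^{g₁Wg₁⁻¹}`;
* `QuasiTemperoid.ptMap_toConnected_map_mk` — `k : G/W₁ → G/W₂`, `k(1·W₁) = cW₂`, sends `g₁W₁ ↦ g₁cW₂`;
* `QuasiTemperoid.exists_fieldMap_eq_of_forall_conj` — **Galois descent**: an element of `K_{G/W₁}` fixed by
  `g₁ c W₂ c⁻¹ g₁⁻¹ = Stab(k(g₁W₁))` is the image under the field map of `k` of an element of `K_{G/W₂}`;
* `QuasiTemperoid.exists_ordIntMapOfHom_eq_pow_of_le_normalCore` — **roots of uniformizers**: if `W₁` lies in the normal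
  core of `Stab(α)`, `α^N = π`, then along `k` the class `[π]` becomes `[hα]^N` (`h` the carrying element; `hα ∈ K_{G/W₁}`
  since that field contains every conjugate of `α`; Galois automorphisms are isometries).

Classical Galois theory / `p`-adic analysis over Mathlib and the landed tree; nothing here bears on [IUTchIII] Cor. 3.12; no
statement of the paper is strengthened.
-/

noncomputable section

open CategoryTheory Opposite Function Topology
open Literature.AnabelianGeometry.SemiGraphs

namespace Literature.AlgebraicGeometry.Frobenioids

namespace QuasiTemperoid

variable (p : ℕ) [Fact p.Prime]

/-! ### Coset objects `G/W` of `B^temp(G_{ℚ_p})⁰`: base points, stabilisers, fixed fields -/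

/-- In the coset object `G_{ℚ_p}/W` (value of the bridge `CosetCat.toConnected` at `X = (W)`), if the chosen base point is
the coset `g₁W`, then `s` stabilises it iff `g₁⁻¹ s g₁ ∈ W`. [cite: MochizukiFrdII2008, Ex 1.3 (i)(ii) p.11] -/
theorem ρ_basePt_eq_iff (X : CosetCat (GalFbar ℚ_[p])) {g₁ : GalFbar ℚ_[p]}
    (hg₁ : (g₁ : X.carrier) = basePt ((CosetCat.toConnected (isTempered_galFbar ℚ_[p])).obj X)) (s : GalFbar ℚ_[p]) :
    ((CosetCat.toConnected (isTempered_galFbar ℚ_[p])).obj X).obj.obj.ρ s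
        (basePt ((CosetCat.toConnected (isTempered_galFbar ℚ_[p])).obj X)) =
      basePt ((CosetCat.toConnected (isTempered_galFbar ℚ_[p])).obj X) ↔ g₁⁻¹ * s * g₁ ∈ X.sg := by
  rw [← hg₁]
  change s • (g₁ : X.carrier) = (g₁ : X.carrier) ↔ _
  rw [MulAction.Quotient.smul_coe, smul_eq_mul, QuotientGroup.eq,
    show (s * g₁)⁻¹ * g₁ = (g₁⁻¹ * s * g₁)⁻¹ by group, inv_mem_iff]
  rfl

/-- Hence the field `K_{G/W} = ℚ̄_p^{Stab(g₁W)} = ℚ̄_p^{g₁Wg₁⁻¹}`: `a ∈ K_{G/W}` iff `a` is fixed by `g₁ w g₁⁻¹` for all `w ∈ W`.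
[cite: MochizukiFrdII2008, Ex 1.3 (iii) pp.11-12] -/
theorem mem_fixFld_toConnected_iff (X : CosetCat (GalFbar ℚ_[p])) {g₁ : GalFbar ℚ_[p]}
    (hg₁ : (g₁ : X.carrier) = basePt ((CosetCat.toConnected (isTempered_galFbar ℚ_[p])).obj X)) (a : Fbar ℚ_[p]) :
    a ∈ fixFld ℚ_[p] ((CosetCat.toConnected (isTempered_galFbar ℚ_[p])).obj X) ↔ ∀ w ∈ X.sg, (g₁ * w * g₁⁻¹) a = a := by
  rw [mem_fixFld_iff]
  constructor
  · intro h w hw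
    refine h _ ((ρ_basePt_eq_iff p X hg₁ _).mpr ?_)
    rw [show g₁⁻¹ * (g₁ * w * g₁⁻¹) * g₁ = w by group]
    exact hw
  · intro h σ hσ
    have h1 := h _ ((ρ_basePt_eq_iff p X hg₁ σ).mp hσ)
    rwa [show g₁ * (g₁⁻¹ * σ * g₁) * g₁⁻¹ = σ by group] at h1

/-- The image of the coset `g₁W₁` under (the bridge image of) `k : G/W₁ → G/W₂` with `k(1·W₁) = cW₂` is `g₁cW₂`.
[cite: MochizukiFrdII2008, Ex 1.3 (i)(ii) p.11] -/
theorem ptMap_toConnected_map_mk {X Y : CosetCat (GalFbar ℚ_[p])} (k : X ⟶ Y) {c : GalFbar ℚ_[p]}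
    (hc : (c : Y.carrier) = CosetCat.pt k) (g₁ : GalFbar ℚ_[p]) :
    ptMap ((CosetCat.toConnected (isTempered_galFbar ℚ_[p])).map k) (g₁ : X.carrier) = ((g₁ * c : GalFbar ℚ_[p]) : Y.carrier) := by
  change CosetCat.Hom.toFun k (g₁ : X.carrier) = _
  rw [CosetCat.toFun_coe, ← hc, MulAction.Quotient.smul_coe, smul_eq_mul]

/-! ### Galois theory at the level of `B^temp(G_{ℚ_p})⁰`: descent along `G/W₁ → G/W₂` -/

/-- **Galois descent along `k : G/W₁ → G/W₂`, `k(1·W₁) = cW₂`** (Galois theory): an element of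
`K_{G/W₁} = ℚ̄_p^{g₁W₁g₁⁻¹}` fixed by `g₁ (c W₂ c⁻¹) g₁⁻¹ = Stab(k(g₁W₁))` is the image, under the field map of `k`, of an
element of `K_{G/W₂}`. This is the form of "`O^⊳(C) ⥲ O^⊳(B)^{Gal(B/C)}`" used over a base `B^temp(Π, Π°)⁰` whose Galois
objects need not be Galois in `B^temp(G_{ℚ_p})⁰`. [cite: MochizukiFrdII2008, Thm 2.4 (i) p.20] -/
theorem exists_fieldMap_eq_of_forall_conj {X Y : CosetCat (GalFbar ℚ_[p])} (k : X ⟶ Y) {c : GalFbar ℚ_[p]}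
    (hc : (c : Y.carrier) = CosetCat.pt k) {g₁ : GalFbar ℚ_[p]}
    (hg₁ : (g₁ : X.carrier) = basePt ((CosetCat.toConnected (isTempered_galFbar ℚ_[p])).obj X))
    (x : fixFld ℚ_[p] ((CosetCat.toConnected (isTempered_galFbar ℚ_[p])).obj X))
    (hx : ∀ w ∈ Y.sg, (g₁ * (c * w * c⁻¹) * g₁⁻¹) (x : Fbar ℚ_[p]) = x) :
    ∃ x₀ : fixFld ℚ_[p] ((CosetCat.toConnected (isTempered_galFbar ℚ_[p])).obj Y),
      fieldMap ((CosetCat.toConnected (isTempered_galFbar ℚ_[p])).map k) x₀ = x := by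
  obtain ⟨g₂, hg₂⟩ := QuotientGroup.mk_surjective
    (basePt ((CosetCat.toConnected (isTempered_galFbar ℚ_[p])).obj Y) : Y.carrier)
  -- the carrying element `h` of the field map: `h · g₂W₂ = k(g₁W₁) = g₁cW₂`, so `w₀ := (h g₂)⁻¹ (g₁ c) ∈ W₂`
  have hh := carrier_spec ((CosetCat.toConnected (isTempered_galFbar ℚ_[p])).map k)
  rw [← hg₁, ptMap_toConnected_map_mk p k hc g₁, ← hg₂] at hh
  change carrier ((CosetCat.toConnected (isTempered_galFbar ℚ_[p])).map k) • (g₂ : Y.carrier) =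
    ((g₁ * c : GalFbar ℚ_[p]) : Y.carrier) at hh
  rw [MulAction.Quotient.smul_coe, smul_eq_mul, QuotientGroup.eq] at hh
  refine ⟨⟨(carrier ((CosetCat.toConnected (isTempered_galFbar ℚ_[p])).map k)).symm (x : Fbar ℚ_[p]), ?_⟩, ?_⟩
  · rw [mem_fixFld_toConnected_iff p Y hg₂]
    intro w hw
    -- `h g₂ w g₂⁻¹ h⁻¹ = g₁ c (w₀⁻¹ w w₀) c⁻¹ g₁⁻¹` fixes `x`
    have hmem : ((carrier ((CosetCat.toConnected (isTempered_galFbar ℚ_[p])).map k) * g₂)⁻¹ * (g₁ * c))⁻¹ * w *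
        ((carrier ((CosetCat.toConnected (isTempered_galFbar ℚ_[p])).map k) * g₂)⁻¹ * (g₁ * c)) ∈ Y.sg :=
      mul_mem (mul_mem (inv_mem hh) hw) hh
    have h1 := hx _ hmem
    rw [show g₁ * (c * (((carrier ((CosetCat.toConnected (isTempered_galFbar ℚ_[p])).map k) * g₂)⁻¹ * (g₁ * c))⁻¹ * w *
        ((carrier ((CosetCat.toConnected (isTempered_galFbar ℚ_[p])).map k) * g₂)⁻¹ * (g₁ * c))) * c⁻¹) * g₁⁻¹ =
        carrier ((CosetCat.toConnected (isTempered_galFbar ℚ_[p])).map k) * (g₂ * w * g₂⁻¹) *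
          (carrier ((CosetCat.toConnected (isTempered_galFbar ℚ_[p])).map k))⁻¹ by group] at h1
    rw [AlgEquiv.mul_apply, AlgEquiv.mul_apply, AlgEquiv.aut_inv] at h1
    have h2 := congrArg (carrier ((CosetCat.toConnected (isTempered_galFbar ℚ_[p])).map k)).symm h1
    rwa [AlgEquiv.symm_apply_apply] at h2
  · apply Subtype.ext
    rw [fieldMap_apply_of_ρ_eq _ (carrier_spec _)]
    exact (carrier ((CosetCat.toConnected (isTempered_galFbar ℚ_[p])).map k)).apply_symm_apply (x : Fbar ℚ_[p])

/-! ### Roots of uniformizers at the level of `B^temp(G_{ℚ_p})⁰` -/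

/-- **Along `k : G/W₁ → G/W₂` with `W₁` inside the normal core of `Stab(α)`, `α^N = π`, the class of `π ∈ O^⊳_{K_{G/W₂}}`
becomes an `N`-th power in `ord(O^⊳_{K_{G/W₁}})`**: the carrying element `h` of the field map sends `π` to `hπ = (hα)^N`, and
`hα ∈ K_{G/W₁}` because `K_{G/W₁} ⊇ ℚ̄_p^{normal core}` contains every conjugate of `α`. [cite: MochizukiFrdII2008, Thm 2.4 (i) p.20] -/
theorem exists_ordIntMapOfHom_eq_pow_of_le_normalCore {X Y : CosetCat (GalFbar ℚ_[p])} (k : X ⟶ Y) {α : Fbar ℚ_[p]}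
    {N : ℕ} (hN : 0 < N) (hW₁ : X.sg.toSubgroup ≤ (MulAction.stabilizer (GalFbar ℚ_[p]) α).normalCore)
    (π : PadicFrd.intNonzero ((galoisPadicFields p).obj ((CosetCat.toConnected (isTempered_galFbar ℚ_[p])).obj Y)).K)
    (hα : α ^ N = Subtype.val π.1) :
    ∃ β : PadicFrd.intNonzero ((galoisPadicFields p).obj ((CosetCat.toConnected (isTempered_galFbar ℚ_[p])).obj X)).K,
      PadicFrd.ordIntMapOfHom ((galoisPadicFields p).map ((CosetCat.toConnected (isTempered_galFbar ℚ_[p])).map k)).alg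
          ((galoisPadicFields p).map ((CosetCat.toConnected (isTempered_galFbar ℚ_[p])).map k)).isValHom
          (Associates.mk π) = Associates.mk β ^ N := by
  obtain ⟨g₁, hg₁⟩ := QuotientGroup.mk_surjective
    (basePt ((CosetCat.toConnected (isTempered_galFbar ℚ_[p])).obj X) : X.carrier)
  have hπmem := (mem_intNonzero_galoisPadicFields_iff p _ π.1).mp π.2
  have hπ0 : (Subtype.val π.1 : Fbar ℚ_[p]) ≠ 0 := fun h => hπmem.2 (Subtype.ext h)
  have hα0 : α ≠ 0 := by
    intro h; rw [h, zero_pow hN.ne'] at hα; exact hπ0 hα.symm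
  -- the field map of `k` is `a ↦ h · a` for the carrying element `h`
  have hfield : ∀ a : ((galoisPadicFields p).obj ((CosetCat.toConnected (isTempered_galFbar ℚ_[p])).obj Y)).K,
      (Subtype.val (((galoisPadicFields p).map ((CosetCat.toConnected (isTempered_galFbar ℚ_[p])).map k)).alg a) :
        Fbar ℚ_[p]) = carrier ((CosetCat.toConnected (isTempered_galFbar ℚ_[p])).map k) (Subtype.val a) := fun a =>
    fieldMap_apply_of_ρ_eq _ (carrier_spec _) a
  -- `β := h α ∈ K_{G/W₁}`: every `s ∈ Stab(g₁W₁) = g₁W₁g₁⁻¹ ⊆ normal core ⊆ Stab(hα)` fixes it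
  have hβmem : carrier ((CosetCat.toConnected (isTempered_galFbar ℚ_[p])).map k) α ∈
      fixFld ℚ_[p] ((CosetCat.toConnected (isTempered_galFbar ℚ_[p])).obj X) := by
    rw [mem_fixFld_toConnected_iff p X hg₁]
    intro w hw
    have h1 : g₁ * w * g₁⁻¹ ∈ (MulAction.stabilizer (GalFbar ℚ_[p]) α).normalCore :=
      (MulAction.stabilizer (GalFbar ℚ_[p]) α).normalCore_normal.conj_mem _ (hW₁ hw) g₁
    have h2 : (carrier ((CosetCat.toConnected (isTempered_galFbar ℚ_[p])).map k))⁻¹ * (g₁ * w * g₁⁻¹) *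
        carrier ((CosetCat.toConnected (isTempered_galFbar ℚ_[p])).map k) ∈
          MulAction.stabilizer (GalFbar ℚ_[p]) α := by
      refine Subgroup.normalCore_le _ ?_
      have := (MulAction.stabilizer (GalFbar ℚ_[p]) α).normalCore_normal.conj_mem _ h1
        (carrier ((CosetCat.toConnected (isTempered_galFbar ℚ_[p])).map k))⁻¹
      rwa [inv_inv] at this
    rw [MulAction.mem_stabilizer_iff, AlgEquiv.smul_def, AlgEquiv.mul_apply, AlgEquiv.mul_apply,
      AlgEquiv.aut_inv, AlgEquiv.symm_apply_eq] at h2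
    exact h2
  have hnormβ : ‖(carrier ((CosetCat.toConnected (isTempered_galFbar ℚ_[p])).map k) α : PadicAlgCl p)‖ ≤ 1 := by
    have hiso : ‖(carrier ((CosetCat.toConnected (isTempered_galFbar ℚ_[p])).map k) α : PadicAlgCl p)‖ =
        ‖(α : PadicAlgCl p)‖ := by
      rw [← PadicAlgCl.spectralNorm_eq, ← PadicAlgCl.spectralNorm_eq, ← spectralNorm_eq_of_equiv]
    rw [hiso]
    have hN' : ‖(α : PadicAlgCl p)‖ ^ N ≤ 1 := by
      rw [← norm_pow]
      have e : (α ^ N : PadicAlgCl p) = (Subtype.val π.1 : PadicAlgCl p) := hα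
      rw [e]; exact hπmem.1
    exact (pow_le_one_iff_of_nonneg (norm_nonneg _) hN.ne').mp hN'
  let β₁ : ((galoisPadicFields p).obj ((CosetCat.toConnected (isTempered_galFbar ℚ_[p])).obj X)).K :=
    ⟨carrier ((CosetCat.toConnected (isTempered_galFbar ℚ_[p])).map k) α, hβmem⟩
  have hβ₁ : Subtype.val β₁ = carrier ((CosetCat.toConnected (isTempered_galFbar ℚ_[p])).map k) α := rfl
  have hβint : β₁ ∈ PadicFrd.intNonzero
      ((galoisPadicFields p).obj ((CosetCat.toConnected (isTempered_galFbar ℚ_[p])).obj X)).K := by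
    refine (mem_intNonzero_galoisPadicFields_iff p _ β₁).mpr ⟨?_, fun h => hα0 ?_⟩
    · rw [hβ₁]; exact hnormβ
    · have h' : carrier ((CosetCat.toConnected (isTempered_galFbar ℚ_[p])).map k) α = 0 := by rw [← hβ₁, h]; rfl
      rwa [map_eq_zero_iff _ (carrier ((CosetCat.toConnected (isTempered_galFbar ℚ_[p])).map k)).injective] at h'
  refine ⟨⟨β₁, hβint⟩, ?_⟩
  rw [PadicFrd.ordIntMapOfHom_mk, ← Associates.mk_pow]
  refine congrArg Associates.mk (Subtype.ext ?_)
  apply Subtype.ext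
  show Subtype.val (((galoisPadicFields p).map ((CosetCat.toConnected (isTempered_galFbar ℚ_[p])).map k)).alg π.1) =
    Subtype.val (Subtype.val ((⟨β₁, hβint⟩ : PadicFrd.intNonzero
      ((galoisPadicFields p).obj ((CosetCat.toConnected (isTempered_galFbar ℚ_[p])).obj X)).K) ^ N))
  rw [hfield, SubmonoidClass.coe_pow]
  show carrier ((CosetCat.toConnected (isTempered_galFbar ℚ_[p])).map k) (Subtype.val π.1) =
    Subtype.val (((⟨carrier ((CosetCat.toConnected (isTempered_galFbar ℚ_[p])).map k) α, hβmem⟩ :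
      ↥(fixFld ℚ_[p] ((CosetCat.toConnected (isTempered_galFbar ℚ_[p])).obj X))) ^ N :
      ↥(fixFld ℚ_[p] ((CosetCat.toConnected (isTempered_galFbar ℚ_[p])).obj X))))
  rw [← hα, map_pow]
  rfl

end QuasiTemperoid

end Literature.AlgebraicGeometry.Frobenioids

end
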